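import Mathlib
import Literature.Combinatorics.SimpleGraph.FKPseudomoments
import HarnessLib

/-!
# The filled-matrix reduction `H_t ⪰ 0 ⟹ M_t(y) ⪰ 0` for Feige–Krauthgamer pseudomoments

Stub `stub_filledReduction` (F) of the line `weil-patch-transfer` for the crux
`Summit.PneNP.PneNP.Theses.RamseyUncertifiable.PaleySosRung` (stmt-PneNP-9817): for every finite
graph `G`, every level `t` and every sequence of levels `α : ℕ → ℝ` with `α₀ = 1`, if the level-`t`
FILLED MATRIX
`H_t[L, R] = α_{|L ∪ R|} · bipInd G L R − α_{|L|} α_{|R|}`, indexed by the NONEMPTY subsets `L, R`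
of size `≤ t`, is positive semidefinite, then so is the truncated moment matrix `M_t(y)` of the
Feige–Krauthgamer pseudomoments `y = fkMoments G α` (`y_S = α_{|S|}` on cliques, `0` elsewhere).

This is the tree's `Literature.Combinatorics.SimpleGraph.posSemidef_momentMatrix_fkMoments`
(Kunisky–Yu 2022, arXiv:2211.02713, §2.3 steps 1–2 with Proposition 3.5) one level up, by the
same argument: with `y_∅ = α₀ = 1` (`fkMoments_empty`), for a test vector `x` on `{S // |S| ≤ t}`,

  `xᵀ M_t(y) x = (x_∅ + Σ_{L ≠ ∅} y_L x_L)² + Σ_{L, R ≠ ∅} x_L x_R (y_{L ∪ R} − y_L y_R)`,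

and `y_{L∪R} − y_L y_R = d_L d_R H_t[L, R]` with `d` the `0/1` clique indicator
(`fkMoments_union_sub_mul`, valid for all finsets), so the second sum is `(d ∘ x)ᵀ H_t (d ∘ x) ≥ 0`.
No hypothesis `1 ≤ t` is needed (at `t = 0` the nonempty index type is empty and `M_0 = (1)`).

Contents: the splitting of (double) sums over `{S // |S| ≤ t}` into the empty set and the
nonempty part (`sum_levelTwo_eq_add_sum_pairIdx` / `sum_sum_levelTwo_eq` with `2 ↦ t`), the
reduction for an arbitrary finite vertex type, and the registered statement on `Fin n`.
-/

set_option linter.dupNamespace false -- `Summit.PneNP.PneNP.…`: summit = sub-problem (D-0017)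

namespace Summit.PneNP.PneNP.Theorems.PaleySosRungWeilPatch

open Literature.Combinatorics.SimpleGraph Finset Matrix

section General

variable {V : Type*} [Fintype V]

/-- Splitting a sum over `{S // |S| ≤ t}` into the empty set and the nonempty sets of size `≤ t`
(the tree's `sum_levelTwo_eq_add_sum_pairIdx` at a general level). -/
theorem filledReduction_sum_level_eq {t : ℕ} (f : {S : Finset V // S.card ≤ t} → ℝ) :
    ∑ I, f I = f ⟨∅, by simp⟩ +
      ∑ L : {S : Finset V // 1 ≤ S.card ∧ S.card ≤ t}, f ⟨L.1, L.2.2⟩ := by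
  classical
  let e : Option {S : Finset V // 1 ≤ S.card ∧ S.card ≤ t} ≃ {S : Finset V // S.card ≤ t} :=
    { toFun := fun o => o.elim ⟨∅, by simp⟩ fun L => ⟨L.1, L.2.2⟩
      invFun := fun I => if h : I.1.card = 0 then none else some ⟨I.1, ⟨by omega, I.2⟩⟩
      left_inv := by
        rintro (_ | ⟨L, hL⟩)
        · simp
        · have h : ¬ L.card = 0 := by omega
          simp [h]
      right_inv := by
        rintro ⟨I, hI⟩
        by_cases h : I.card = 0
        · have hI0 : I = ∅ := card_eq_zero.1 h
          subst hI0
          simp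
        · simp [h] }
  rw [← Fintype.sum_equiv e (fun o => f (e o)) f (fun _ => rfl), Fintype.sum_option]
  rfl

/-- Splitting a double sum over `{S // |S| ≤ t}` into its `∅/∅`, `∅/±`, `±/∅`, `±/±` parts
(the tree's `sum_sum_levelTwo_eq` at a general level). -/
theorem filledReduction_sum_sum_level_eq {t : ℕ}
    (F : {S : Finset V // S.card ≤ t} → {S : Finset V // S.card ≤ t} → ℝ) :
    ∑ I, ∑ J, F I J = F ⟨∅, by simp⟩ ⟨∅, by simp⟩ +
      ∑ R : {S : Finset V // 1 ≤ S.card ∧ S.card ≤ t}, F ⟨∅, by simp⟩ ⟨R.1, R.2.2⟩ +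
      ∑ L : {S : Finset V // 1 ≤ S.card ∧ S.card ≤ t}, F ⟨L.1, L.2.2⟩ ⟨∅, by simp⟩ +
      ∑ L : {S : Finset V // 1 ≤ S.card ∧ S.card ≤ t},
        ∑ R : {S : Finset V // 1 ≤ S.card ∧ S.card ≤ t}, F ⟨L.1, L.2.2⟩ ⟨R.1, R.2.2⟩ := by
  have h1 : ∀ I : {S : Finset V // S.card ≤ t}, ∑ J, F I J = F I ⟨∅, by simp⟩ +
      ∑ R : {S : Finset V // 1 ≤ S.card ∧ S.card ≤ t}, F I ⟨R.1, R.2.2⟩ := fun I =>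
    filledReduction_sum_level_eq (F I)
  simp only [h1]
  rw [filledReduction_sum_level_eq, Finset.sum_add_distrib]
  ring

variable [DecidableEq V] (G : SimpleGraph V) [DecidableRel G.Adj]

/-- **`H_t ⪰ 0 ⟹ M_t(y) ⪰ 0` for FK pseudomoments at every level** (Kunisky–Yu §2.3, steps 1–2,
with Proposition 3.5, for an arbitrary finite graph and arbitrary levels with `α₀ = 1`): the
identity `xᵀ M_t(y) x = (x_∅ + Σ_L y_L x_L)² + (d ∘ x)ᵀ H_t (d ∘ x)` with `d` the clique indicator. -/
theorem posSemidef_momentMatrix_fkMoments_of_filled (t : ℕ) (α : ℕ → ℝ) (hα : α 0 = 1)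
    (hH : (Matrix.of fun L R : {S : Finset V // 1 ≤ S.card ∧ S.card ≤ t} =>
      α (L.1 ∪ R.1).card * bipInd G L.1 R.1 - α L.1.card * α R.1.card).PosSemidef) :
    (momentMatrix t (fkMoments G α)).PosSemidef := by
  classical
  set y := fkMoments G α with hy
  have hy0 : y ∅ = 1 := by rw [hy, fkMoments_empty, hα]
  refine PosSemidef.of_dotProduct_mulVec_nonneg ?_ fun x => ?_
  · ext I J
    simp only [conjTranspose_apply, star_trivial, momentMatrix_apply, union_comm]
  -- notation
  let x0 : ℝ := x ⟨∅, by simp⟩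
  let xx : {S : Finset V // 1 ≤ S.card ∧ S.card ≤ t} → ℝ := fun L => x ⟨L.1, L.2.2⟩
  let d : {S : Finset V // 1 ≤ S.card ∧ S.card ≤ t} → ℝ := fun L =>
    if G.IsClique (L.1 : Set V) then 1 else 0
  let z : {S : Finset V // 1 ≤ S.card ∧ S.card ≤ t} → ℝ := fun L => d L * xx L
  let s : ℝ := ∑ L : {S : Finset V // 1 ≤ S.card ∧ S.card ≤ t}, y L.1 * xx L
  let W : ℝ := ∑ L : {S : Finset V // 1 ≤ S.card ∧ S.card ≤ t},
    ∑ R : {S : Finset V // 1 ≤ S.card ∧ S.card ≤ t}, xx L * xx R * y (L.1 ∪ R.1)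
  -- the moment quadratic form
  have hQ : star x ⬝ᵥ (momentMatrix t y *ᵥ x) = x0 ^ 2 + 2 * x0 * s + W := by
    have h1 : star x ⬝ᵥ (momentMatrix t y *ᵥ x) = ∑ I, ∑ J, x I * (y (I.1 ∪ J.1) * x J) := by
      simp only [star_trivial, dotProduct, mulVec, momentMatrix_apply, Finset.mul_sum]
    rw [h1, filledReduction_sum_sum_level_eq (fun I J => x I * (y (I.1 ∪ J.1) * x J))]
    have e00 : x ⟨∅, by simp⟩ * (y (∅ ∪ ∅) * x ⟨∅, by simp⟩) = x0 ^ 2 := by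
      rw [union_empty, hy0]; simp only [x0]; ring
    have e0R : ∑ R : {S : Finset V // 1 ≤ S.card ∧ S.card ≤ t},
        x ⟨∅, by simp⟩ * (y (∅ ∪ R.1) * x ⟨R.1, R.2.2⟩) = x0 * s := by
      simp only [s, Finset.mul_sum, empty_union, xx, x0]
    have eL0 : ∑ L : {S : Finset V // 1 ≤ S.card ∧ S.card ≤ t},
        x ⟨L.1, L.2.2⟩ * (y (L.1 ∪ ∅) * x ⟨∅, by simp⟩) = x0 * s := by
      simp only [s, Finset.mul_sum, union_empty, xx, x0]
      exact Finset.sum_congr rfl fun L _ => by ring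
    have eLR : ∑ L : {S : Finset V // 1 ≤ S.card ∧ S.card ≤ t},
        ∑ R : {S : Finset V // 1 ≤ S.card ∧ S.card ≤ t},
          x ⟨L.1, L.2.2⟩ * (y (L.1 ∪ R.1) * x ⟨R.1, R.2.2⟩) = W := by
      simp only [W, xx]
      exact Finset.sum_congr rfl fun L _ => Finset.sum_congr rfl fun R _ => by ring
    rw [e00, e0R, eL0, eLR]
    ring
  -- the `H` quadratic form
  have hR : star z ⬝ᵥ ((Matrix.of fun L R : {S : Finset V // 1 ≤ S.card ∧ S.card ≤ t} =>
      α (L.1 ∪ R.1).card * bipInd G L.1 R.1 - α L.1.card * α R.1.card) *ᵥ z) = W - s ^ 2 := by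
    simp only [star_trivial, dotProduct, mulVec, Matrix.of_apply, Finset.mul_sum]
    have hz : ∀ L R : {S : Finset V // 1 ≤ S.card ∧ S.card ≤ t},
        z L * ((α (L.1 ∪ R.1).card * bipInd G L.1 R.1 - α L.1.card * α R.1.card) * z R) =
          xx L * xx R * y (L.1 ∪ R.1) - y L.1 * xx L * (y R.1 * xx R) := by
      intro L R
      have h := fkMoments_union_sub_mul G α L.1 R.1
      rw [← hy] at h
      simp only [z, d]
      linear_combination (-(xx L * xx R)) * h
    simp only [hz, Finset.sum_sub_distrib]
    congr 1
    rw [sq, Finset.sum_mul_sum]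
  have h0 : 0 ≤ star z ⬝ᵥ ((Matrix.of fun L R : {S : Finset V // 1 ≤ S.card ∧ S.card ≤ t} =>
      α (L.1 ∪ R.1).card * bipInd G L.1 R.1 - α L.1.card * α R.1.card) *ᵥ z) :=
    hH.dotProduct_mulVec_nonneg z
  rw [hQ]
  rw [hR] at h0
  nlinarith [sq_nonneg (x0 + s)]

end General

/-- **(F) The filled-matrix reduction at every level, for every finite graph on `Fin n`** — the
registered stub `stub_filledReduction` of the line `weil-patch-transfer` (crux `PaleySosRung`,
stmt-PneNP-9817): with `y = fkMoments G α`, `α₀ = 1`, and the level-`t` filled matrix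
`H[L,R] = α_{|L∪R|}·bipInd G L R − α_{|L|}α_{|R|}` on NONEMPTY subsets of size `≤ t`,
`H ⪰ 0 ⟹ M_t(y) ⪰ 0` (Kunisky–Yu 2022, §2.3 and Prop. 3.5, one level up). -/
theorem stub_filledReduction :
    ∀ (n t : ℕ) (G : SimpleGraph (Fin n)) [DecidableRel G.Adj] (α : ℕ → ℝ), α 0 = 1 →
      (Matrix.of fun L R : {S : Finset (Fin n) // 1 ≤ S.card ∧ S.card ≤ t} =>
          α (L.1 ∪ R.1).card * bipInd G L.1 R.1 - α L.1.card * α R.1.card).PosSemidef →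
      (momentMatrix t (fkMoments G α)).PosSemidef :=
  fun _ t G _ α hα hH => posSemidef_momentMatrix_fkMoments_of_filled G t α hα hH

end Summit.PneNP.PneNP.Theorems.PaleySosRungWeilPatch
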